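import Literature.NumberTheory.LFunctions.RHInvZetaBound
import HarnessLib

/-!
# A sub-polynomial bound at the edge of absolute convergence (Hadamard's three circles)

Topic `NumberTheory/LFunctions`; namespace `Literature.NumberTheory.LFunctions`. Theorems only (no
definition, no named fact; D-0026).

The classical mechanism behind bounds of the type `L(1, π) ≪_ε q(π)^ε` when only a POLYNOMIAL bound
for the continued `L`-function is known on a fixed disc around `s = 1` (e.g. a convexity bound
`‖L(s, π)‖ ≤ B q^κ` on `|s - 2| ≤ 3/2`) together with the TRIVIAL bound
`‖L(s, π)‖ ≤ A (σ - 1)^{-k}` in the half-plane of absolute convergence: Hadamard's three-circles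
theorem for the circles centred at `1 + η`, `η = 1/log M`, through `1 + η/2` (trivial bound
`A (2 log M)^k`), `1` and `1 + r/2` (polynomial bound `M`) gives
`‖L(1)‖ ≤ (A (2 log M)^k)^{1-a} M^a` with `a = log 2 / log (r log M) → 0`, i.e. `‖L(1)‖ ≪_ε (A + 1) M^ε`
(Titchmarsh, *The Theory of the Riemann Zeta-Function*, §14.2, the three-circles step of
Littlewood's argument, there applied to `log ζ`; Iwaniec–Kowalski §5.2 for the convexity context).
Stated for an arbitrary holomorphic `g` on a disc `|s - s₀| < r` bounded by `M` there and by
`A / (Re s - Re s₀)^k` on its right half: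

* `norm_le_mul_rpow_of_edgeBound_aux` — the three-circles inequality with the parameter `η` free;
* `exists_norm_le_mul_rpow_of_edgeBound` — **main**: for `k`, `r > 0`, `ε > 0` there is
  `C = C(k, r, ε) > 0` with `‖g s₀‖ ≤ C (A + 1) M^ε` for all such `g`, `s₀`, `A ≥ 0`, `M ≥ 1`.

Used by `EllipticCurves/NewformPeterssonSizePairSelbergReductionProofs` to discharge the value bound
`|L(1, Sym² f_i × Sym² f_j)| ≪_η (N_iN_j)^η` of Hoffstein–Lockhart's Siegel argument from the
convexity bound of a Selberg datum.

## References

* E. C. Titchmarsh, *The Theory of the Riemann Zeta-Function*, 2nd ed. (1986), §14.2 (three circles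
  between the half-plane of absolute convergence and a disc bound). [Titchmarsh1986]
* H. Iwaniec, E. Kowalski, *Analytic Number Theory* (2004), §5.2 (convexity bounds). [IwaniecKowalski2004]

## Mathlib / tree search

Tree: `Literature.NumberTheory.LFunctions.InvZetaRH.norm_le_of_three_circles` (Hadamard's three
circles from Mathlib's three-lines theorem, `RHInvZetaBound.lean`) — reused. Mathlib:
`Real.log_le_rpow_div`, `Real.rpow_le_rpow_of_exponent_le`, `Real.rpow_natCast`,
`Real.one_le_rpow`. `lean search 'edge|subconvex|three_circles'`: no statement of this kind in the tree.
-/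

noncomputable section

open Complex Metric Set Real

namespace Literature.NumberTheory.LFunctions

open InvZetaRH (norm_le_of_three_circles)

/-- **Three circles at the edge, parameter form.** Let `g` be holomorphic on `|s - s₀| < r` with
`‖g s‖ ≤ M` there and `‖g s‖ ≤ A / (Re s - Re s₀)^k` at the points with `Re s > Re s₀`. Then for
`0 < η ≤ r/4` and `M₁ ≥ max (1, A (2/η)^k)`, `M ≥ 0`:
`‖g s₀‖ ≤ M₁^{1-a} M^{a}` with `a = log 2 / log (r/η)` (circles centred `s₀ + η` of radii `η/2`,
`η`, `r/2`; `A ≥ 0`). [cite: Titchmarsh1986, §14.2] -/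
theorem norm_le_mul_rpow_of_edgeBound_aux {g : ℂ → ℂ} {s₀ : ℂ} {r A M η M₁ : ℝ} (k : ℕ)
    (hr : 0 < r) (hη : 0 < η) (hηr : η ≤ r / 4)
    (hg : DifferentiableOn ℂ g (ball s₀ r))
    (hM : ∀ s ∈ ball s₀ r, ‖g s‖ ≤ M)
    (hA0 : 0 ≤ A) (hA : ∀ s ∈ ball s₀ r, s₀.re < s.re → ‖g s‖ ≤ A / (s.re - s₀.re) ^ k)
    (hM₁ : A * (2 / η) ^ k ≤ M₁) :
    ‖g s₀‖ ≤ M₁ ^ (1 - Real.log 2 / Real.log (r / η)) * M ^ (Real.log 2 / Real.log (r / η)) := by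
  -- the three circles are centred at `c = s₀ + η`
  set c : ℂ := s₀ + η with hc
  have hzc : s₀ - c = -(η : ℂ) := by rw [hc]; ring
  have hnorm : ‖s₀ - c‖ = η := by rw [hzc, norm_neg, Complex.norm_real, Real.norm_eq_abs, abs_of_pos hη]
  -- `g` is holomorphic on `ball c (r - η) ⊆ ball s₀ r`
  have hηnorm : ‖(η : ℂ)‖ = η := by rw [Complex.norm_real, Real.norm_eq_abs, abs_of_pos hη]
  have hsub : ball c (r - η) ⊆ ball s₀ r := by
    intro z hz
    rw [mem_ball, dist_eq_norm] at hz ⊢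
    calc ‖z - s₀‖ = ‖(z - c) + (η : ℂ)‖ := by rw [hc]; ring_nf
      _ ≤ ‖z - c‖ + ‖(η : ℂ)‖ := norm_add_le _ _
      _ < (r - η) + η := by rw [hηnorm]; linarith
      _ = r := by ring
  have hgd : DifferentiableOn ℂ g (ball c (r - η)) := hg.mono hsub
  -- bound on the inner circle `‖z - c‖ = η/2`: the trivial bound
  have hin : ∀ z : ℂ, ‖z - c‖ = η / 2 → ‖g z‖ ≤ M₁ := by
    intro z hz
    have hzball : z ∈ ball s₀ r := by
      rw [mem_ball, dist_eq_norm]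
      calc ‖z - s₀‖ = ‖(z - c) + (η : ℂ)‖ := by rw [hc]; ring_nf
        _ ≤ ‖z - c‖ + ‖(η : ℂ)‖ := norm_add_le _ _
        _ = η / 2 + η := by rw [hz, Complex.norm_real, Real.norm_eq_abs, abs_of_pos hη]
        _ < r := by linarith
    have hre : s₀.re + η / 2 ≤ z.re := by
      have h1 : |(z - c).re| ≤ ‖z - c‖ := Complex.abs_re_le_norm _
      rw [hz] at h1
      have h2 : (z - c).re = z.re - s₀.re - η := by simp [hc]; ring
      rw [h2] at h1
      have := neg_abs_le (z.re - s₀.re - η)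
      linarith
    have hpos : s₀.re < z.re := by linarith
    have hk : A / (z.re - s₀.re) ^ k ≤ A * (2 / η) ^ k := by
      rw [div_eq_mul_inv, ← inv_pow]
      apply mul_le_mul_of_nonneg_left _ hA0
      apply pow_le_pow_left₀ (inv_nonneg.2 (by linarith))
      rw [inv_eq_one_div, div_le_div_iff₀ (by linarith) hη]
      linarith
    exact ((hA z hzball hpos).trans hk).trans hM₁
  -- bound on the outer circle `‖z - c‖ = r/2`: the disc bound
  have hout : ∀ z : ℂ, ‖z - c‖ = r / 2 → ‖g z‖ ≤ M := by
    intro z hz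
    apply hM
    rw [mem_ball, dist_eq_norm]
    calc ‖z - s₀‖ = ‖(z - c) + (η : ℂ)‖ := by rw [hc]; ring_nf
      _ ≤ ‖z - c‖ + ‖(η : ℂ)‖ := norm_add_le _ _
      _ = r / 2 + η := by rw [hz, Complex.norm_real, Real.norm_eq_abs, abs_of_pos hη]
      _ < r := by linarith
  -- three circles at `z = s₀`, `‖s₀ - c‖ = η`
  have key := norm_le_of_three_circles (F := g) (c := c) (R := r - η) (r₁ := η / 2) (r₃ := r / 2)
    (M₁ := M₁) (M₃ := M) (by positivity) (by linarith) (by linarith) hgd hin hout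
    (z := s₀) (by rw [hnorm]; linarith) (by rw [hnorm]; linarith)
  have h2 : ‖s₀ - c‖ / (η / 2) = 2 := by rw [hnorm]; field_simp
  have h3 : r / 2 / (η / 2) = r / η := by field_simp
  rw [h2, h3] at key
  exact key

/-- **A sub-polynomial bound at the edge of absolute convergence.** For `k : ℕ`, `r > 0` and
`ε > 0` there is `C = C(k, r, ε) > 0` such that: whenever `g` is holomorphic on the disc
`|s - s₀| < r`, bounded there by `M ≥ 1`, and satisfies the "trivial bound"
`‖g s‖ ≤ A / (Re s - Re s₀)^k` (`A ≥ 0`) at the points of the disc to the right of `s₀`, then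
`‖g s₀‖ ≤ C (A + 1) M^ε`. (Three circles with `η = min (r/E, 1/max(1, log M))`,
`E = max (4, 2^{2/ε})`: the exponent `a = log 2/log (r/η) ≤ ε/2`, and
`A (2/η)^k ≤ A 2^k (E/r + 1)^k (1 + log M)^k ≤ A 2^k (E/r+1)^k (1 + 2k/ε)^k M^{ε/2}` by
`log M ≤ M^δ/δ`, `δ = ε/(2k)`.) In the application `s₀ = 1`, `g = L(s, π)` continued, `M = B q^κ`
a convexity bound and `A (σ-1)^{-k}` the bound `ζ(σ)^k` of a degree-`k` Euler product with
unitary parameters: `L(1, π) ≪_ε q^ε`. [cite: Titchmarsh1986, §14.2] -/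
theorem exists_norm_le_mul_rpow_of_edgeBound (k : ℕ) {r : ℝ} (hr : 0 < r) {ε : ℝ} (hε : 0 < ε) :
    ∃ C : ℝ, 0 < C ∧ ∀ (g : ℂ → ℂ) (s₀ : ℂ) (A M : ℝ), 0 ≤ A → 1 ≤ M →
      DifferentiableOn ℂ g (ball s₀ r) →
      (∀ s ∈ ball s₀ r, ‖g s‖ ≤ M) →
      (∀ s ∈ ball s₀ r, s₀.re < s.re → ‖g s‖ ≤ A / (s.re - s₀.re) ^ k) →
      ‖g s₀‖ ≤ C * (A + 1) * M ^ ε := by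
  -- constants
  set E : ℝ := max 4 ((2 : ℝ) ^ (2 / ε)) with hE
  have hE4 : 4 ≤ E := le_max_left _ _
  have hE0 : 0 < E := by linarith
  have hEε : (2 : ℝ) ^ (2 / ε) ≤ E := le_max_right _ _
  set δ : ℝ := ε / (2 * (k + 1)) with hδ
  have hδ0 : 0 < δ := by rw [hδ]; positivity
  set K : ℝ := (2 : ℝ) ^ k * (E / r + 1) ^ k * (1 / δ + 1) ^ k with hK
  have hK1 : 1 ≤ K := by
    rw [hK]
    have h1 : (1 : ℝ) ≤ 2 ^ k := one_le_pow₀ (by norm_num)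
    have h2 : (1 : ℝ) ≤ (E / r + 1) ^ k := one_le_pow₀ (by have := div_pos hE0 hr; linarith)
    have h3 : (1 : ℝ) ≤ (1 / δ + 1) ^ k := one_le_pow₀ (by have := one_div_pos.2 hδ0; linarith)
    calc (1 : ℝ) = 1 * 1 * 1 := by ring
      _ ≤ 2 ^ k * (E / r + 1) ^ k * (1 / δ + 1) ^ k := by gcongr
  refine ⟨K, by linarith, ?_⟩
  intro g s₀ A M hA0 hM1 hg hM hA
  -- the parameter `η`
  set L : ℝ := max 1 (Real.log M) with hL
  have hL1 : 1 ≤ L := le_max_left _ _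
  have hL0 : 0 < L := by linarith
  have hlogM : Real.log M ≤ L := le_max_right _ _
  have hlogM0 : 0 ≤ Real.log M := Real.log_nonneg hM1
  set η : ℝ := min (r / E) (1 / L) with hη
  have hη0 : 0 < η := lt_min (div_pos hr hE0) (one_div_pos.2 hL0)
  have hηE : η ≤ r / E := min_le_left _ _
  have hηL : η ≤ 1 / L := min_le_right _ _
  have hηr : η ≤ r / 4 := hηE.trans (div_le_div_of_nonneg_left hr.le (by norm_num) hE4)
  -- `r/η ≥ E ≥ 2^{2/ε}`, so the exponent `a ≤ ε/2`
  have hrη : E ≤ r / η := by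
    rw [le_div_iff₀ hη0]
    calc E * η ≤ E * (r / E) := by gcongr
      _ = r := by field_simp
  have hrη1 : 1 < r / η := by linarith
  have hlog0 : 0 < Real.log (r / η) := Real.log_pos hrη1
  set a : ℝ := Real.log 2 / Real.log (r / η) with ha
  have ha0 : 0 ≤ a := div_nonneg (Real.log_nonneg (by norm_num)) hlog0.le
  have haε : a ≤ ε / 2 := by
    rw [ha, div_le_iff₀ hlog0]
    have h1 : Real.log ((2 : ℝ) ^ (2 / ε)) ≤ Real.log (r / η) :=
      Real.log_le_log (by positivity) (hEε.trans hrη)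
    rw [Real.log_rpow (by norm_num)] at h1
    have h2 : ε / 2 * Real.log (r / η) ≥ ε / 2 * (2 / ε * Real.log 2) :=
      mul_le_mul_of_nonneg_left h1 (by positivity)
    have h3 : ε / 2 * (2 / ε * Real.log 2) = Real.log 2 := by field_simp
    linarith
  have ha1 : a ≤ 1 := by
    rw [ha, div_le_one hlog0]
    apply Real.log_le_log (by norm_num)
    linarith
  -- `1/η ≤ E/r + L ≤ (E/r + 1) (1 + log M)`
  have hinvη : 1 / η ≤ (E / r + 1) * (1 + Real.log M) := by
    have hEr0 : 0 ≤ E / r := by positivity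
    have hLle : L ≤ 1 + Real.log M := by
      rw [hL]; exact max_le (by linarith) (by linarith)
    have h1 : 1 / η ≤ E / r + L := by
      rcases le_total (r / E) (1 / L) with h | h
      · have hη' : η = r / E := by rw [hη, min_eq_left h]
        rw [hη', one_div_div]
        linarith
      · have hη' : η = 1 / L := by rw [hη, min_eq_right h]
        rw [hη', one_div_one_div]
        linarith
    calc 1 / η ≤ E / r + L := h1
      _ ≤ E / r + (1 + Real.log M) := by linarith
      _ ≤ (E / r + 1) * (1 + Real.log M) := by nlinarith
  -- `1 + log M ≤ (1/δ + 1) M^δ`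
  have hMδ1 : 1 ≤ M ^ δ := Real.one_le_rpow hM1 hδ0.le
  have hlogle : 1 + Real.log M ≤ (1 / δ + 1) * M ^ δ := by
    have h := Real.log_le_rpow_div (by linarith : (0 : ℝ) ≤ M) hδ0
    calc 1 + Real.log M ≤ M ^ δ + M ^ δ / δ := by linarith
      _ = (1 / δ + 1) * M ^ δ := by ring
  -- `(M^δ)^k ≤ M^{ε/2}`
  have hMδk : (M ^ δ) ^ k ≤ M ^ (ε / 2) := by
    rw [← Real.rpow_natCast, ← Real.rpow_mul (by linarith)]
    apply Real.rpow_le_rpow_of_exponent_le hM1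
    rw [hδ]
    have hk0 : (0 : ℝ) ≤ k := Nat.cast_nonneg k
    rw [div_mul_eq_mul_div, div_le_div_iff₀ (by positivity) (by norm_num)]
    nlinarith
  -- the trivial-bound constant `M₁`
  set M₁ : ℝ := (A + 1) * K * M ^ (ε / 2) with hM₁def
  have hMε1 : 1 ≤ M ^ (ε / 2) := Real.one_le_rpow hM1 (by positivity)
  have hM₁1 : 1 ≤ M₁ := by
    rw [hM₁def]
    calc (1 : ℝ) = 1 * 1 * 1 := by ring
      _ ≤ (A + 1) * K * M ^ (ε / 2) := by gcongr; linarith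
  have hM₁ : A * (2 / η) ^ k ≤ M₁ := by
    have h2η : 2 / η ≤ 2 * ((E / r + 1) * ((1 / δ + 1) * M ^ δ)) := by
      rw [div_eq_mul_one_div]
      apply mul_le_mul_of_nonneg_left _ (by norm_num)
      exact hinvη.trans (mul_le_mul_of_nonneg_left hlogle (by positivity))
    have h2η0 : 0 ≤ 2 / η := by positivity
    calc A * (2 / η) ^ k ≤ A * (2 * ((E / r + 1) * ((1 / δ + 1) * M ^ δ))) ^ k := by
          gcongr
      _ = A * (2 ^ k * (E / r + 1) ^ k * (1 / δ + 1) ^ k) * (M ^ δ) ^ k := by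
          rw [mul_pow, mul_pow, mul_pow]; ring
      _ = A * K * (M ^ δ) ^ k := by rw [hK]
      _ ≤ A * K * M ^ (ε / 2) := by
          apply mul_le_mul_of_nonneg_left hMδk
          exact mul_nonneg hA0 (by linarith)
      _ ≤ (A + 1) * K * M ^ (ε / 2) := by
          apply mul_le_mul_of_nonneg_right _ (by linarith)
          apply mul_le_mul_of_nonneg_right (by linarith) (by linarith)
  -- apply the parameter form
  have key := norm_le_mul_rpow_of_edgeBound_aux k hr hη0 hηr hg hM hA0 hA hM₁
  -- `M₁^{1-a} ≤ M₁`, `M^a ≤ M^{ε/2}`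
  have h1 : M₁ ^ (1 - a) ≤ M₁ := by
    conv_rhs => rw [← Real.rpow_one M₁]
    exact Real.rpow_le_rpow_of_exponent_le hM₁1 (by linarith)
  have h2 : M ^ a ≤ M ^ (ε / 2) := Real.rpow_le_rpow_of_exponent_le hM1 haε
  calc ‖g s₀‖ ≤ M₁ ^ (1 - a) * M ^ a := key
    _ ≤ M₁ * M ^ (ε / 2) :=
        mul_le_mul h1 h2 (Real.rpow_nonneg (by linarith) _) (by linarith)
    _ = (A + 1) * K * (M ^ (ε / 2) * M ^ (ε / 2)) := by rw [hM₁def]; ring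
    _ = K * (A + 1) * M ^ ε := by
        have hεε : M ^ (ε / 2) * M ^ (ε / 2) = M ^ ε := by
          rw [← Real.rpow_add (by linarith), add_halves]
        rw [hεε]; ring

end Literature.NumberTheory.LFunctions

end
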